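import Literature.Claims.NS.PereiraSilva2025
import Summits.NavierStokesRegularity.NavierStokesRegularity.Theorems.SoloRefuteLucardoOlivaes2026
import Literature.Analysis.FluidPDE.NSLerayHopfSereginEnergyProofs
import Mathlib.MeasureTheory.Measure.Lebesgue.EqHaar
import Summits.NavierStokesRegularity.NavierStokesRegularity.Theorems.TypeILiouvilleTypeIliouvilleNoTypeIIStubThreeFifthsLawCurl
import HarnessLib

/-!
# C149 `PereiraSilva2025` — refuter kit, SUPPORT displays (ns-claims-refuter-1 g4)

Companion of `SoloRefutePereiraSilva2025.lean` (same skeleton and text of record). Kernel objects, every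
`K : Consts`:
* `not_Step2_GN K : ¬ Step2_GN K` — §2 p.2 l.24–28 (used p.3 l.45–47): the Gagliardo–Nirenberg display with
  the 2-D exponents `2/3, 1/3` is dilation-inhomogeneous on `ℝ³` (`x ↦ u0(c x)`, `c → ∞`; left side `∝ c⁻¹`,
  right side `∝ c^{-7/6}`) — the first false printed sentence, whose product on the composition path is
  «Combining» p.3 l.143–147.
* `not_Step2_Poincare K : ¬ Step2_Poincare K` — §2 p.2 l.29–34: no Poincaré inequality on `ℝ³` (`c → 0`).
* `not_Step32_Young : ¬ Step32_Young` — p.3 l.95–111 as printed, at `S = X = 3` (`9 ≤ 5`).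
Helper lemmas live in the sub-namespace `Support` (no name shared with the main kit). [folklore]

WHAT THIS IS NOT: not a claim about NS regularity or blow-up; not a claim about any author beyond the
typed locator.
-/

set_option linter.dupNamespace false

noncomputable section

open Real Set Function MeasureTheory
open scoped ENNReal NNReal ContDiff

namespace Summit.NavierStokesRegularity.NavierStokesRegularity.Theorems.PereiraSilva2025

open Summit.NavierStokesRegularity.NavierStokesRegularity.Theorems.TypeIliouvilleNoTypeII.GradientPivot
  (curl_comp_smul) -- landed copy (dedup.landed fix-up by the filer; the kit's byte-identical lemma removed)

open Literature.Analysis Literature.Analysis.FluidPDE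
open Literature.Claims.NS.PereiraSilva2025
open Literature.Claims.NS.Chae2007 (IsDatum)
open Literature.Claims.NS.LucardoOlivaes2026 (E3 IsOuroDatum)
open Literature.Claims.NS.PaiLimsuwan2026 (SlabSol)
open Summit.NavierStokesRegularity.NavierStokesRegularity.Theorems.LucardoOlivaes2026
  (u0 isOuroDatum_u0 contDiff_u0 hasCompactSupport_u0 isDivFree_u0 ens_pos isDatum_smul curl_smul_fun
  exists_isLocalSolution)

namespace Support

/-- `∫ f(c x) dx = c⁻³ ∫ f` on `ℝ³`. [folklore] -/
theorem integral_comp_smul_fin3 (f : E3 → ℝ) {c : ℝ} (hc : 0 < c) :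
    ∫ x, f (c • x) = (c ^ 3)⁻¹ * ∫ y, f y := by
  rw [Measure.integral_comp_smul volume f c, finrank_euclideanSpace_fin, smul_eq_mul,
    abs_of_nonneg (by positivity)]

/-- kit lemma (plumbing) [folklore] -/ theorem curl_comp_smul_fun (v : E3 → E3) (c : ℝ) :
    curl (fun y => v (c • y)) = fun x => c • curl v (c • x) :=
  funext (curl_comp_smul v c)

/-- `∇(curl v(c ·))(x) = c² • (∇ curl v)(c x)`. [folklore] -/
theorem fderiv_curl_comp_smul (v : E3 → E3) (c : ℝ) (x : E3) :
    fderiv ℝ (curl (fun y => v (c • y))) x = (c * c) • fderiv ℝ (curl v) (c • x) := by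
  rw [curl_comp_smul_fun]
  show fderiv ℝ (c • fun z => curl v (c • z)) x = _
  rw [fderiv_const_smul_field, Pi.smul_apply, fderiv_comp_smul, smul_smul]

/-- `∫|f(c·)|^n = c⁻³ ∫|f|^n`. [folklore] -/
theorem integral_norm_comp_smul_pow (f : E3 → E3) (n : ℕ) {c : ℝ} (hc : 0 < c) :
    ∫ x, ‖f (c • x)‖ ^ n = (c ^ 3)⁻¹ * ∫ x, ‖f x‖ ^ n :=
  integral_comp_smul_fin3 (fun y => ‖f y‖ ^ n) hc

/-- Enstrophy: `∫|curl v(c·)|² = c⁻¹ ∫|curl v|²`. [folklore] -/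
theorem l2sq_curl_comp_smul (v : E3 → E3) {c : ℝ} (hc : 0 < c) :
    l2sq (curl (fun y => v (c • y))) = c⁻¹ * l2sq (curl v) := by
  unfold l2sq
  simp_rw [curl_comp_smul, norm_smul, mul_pow]
  rw [integral_const_mul, integral_comp_smul_fin3 (fun y => ‖curl v y‖ ^ 2) hc, ← mul_assoc,
    Real.norm_eq_abs, abs_of_pos hc]
  congr 1
  field_simp

/-- `gradsqF (f(c·)) = c⁻¹ gradsqF f` (the Frobenius form `∫ Σⱼ|∂ⱼf|²`). [folklore] -/
theorem gradsqF_comp_smul (f : E3 → E3) {c : ℝ} (hc : 0 < c) :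
    gradsqF (fun y => f (c • y)) = c⁻¹ * gradsqF f := by
  unfold gradsqF
  simp_rw [fderiv_comp_smul, FunLike.coe_smul, Pi.smul_apply, norm_smul, mul_pow, ← Finset.mul_sum]
  rw [integral_const_mul, integral_comp_smul_fin3
    (fun y => ∑ j : Fin 3, ‖fderiv ℝ f y (EuclideanSpace.single j 1)‖ ^ 2) hc, ← mul_assoc,
    Real.norm_eq_abs, abs_of_pos hc]
  congr 1
  field_simp

/-- `gradsqF (curl v(c·)) = c · gradsqF (curl v)`. [folklore] -/
theorem gradsqF_curl_comp_smul (v : E3 → E3) {c : ℝ} (hc : 0 < c) :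
    gradsqF (curl (fun y => v (c • y))) = c * gradsqF (curl v) := by
  unfold gradsqF
  simp_rw [fderiv_curl_comp_smul, FunLike.coe_smul, Pi.smul_apply, norm_smul, mul_pow, ← Finset.mul_sum]
  rw [integral_const_mul, integral_comp_smul_fin3
    (fun y => ∑ j : Fin 3, ‖fderiv ℝ (curl v) y (EuclideanSpace.single j 1)‖ ^ 2) hc, ← mul_assoc,
    Real.norm_eq_abs, abs_of_nonneg (mul_self_nonneg c)]
  congr 1
  field_simp


/-- kit lemma (plumbing) [folklore] -/ theorem u0_ne_zero : u0 ≠ 0 := by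
  intro h
  apply isOuroDatum_u0.2.2
  have : curl u0 = curl ((0 : ℝ) • u0) := by rw [zero_smul, h]
  rw [this, curl_smul_fun]
  funext x
  simp

/-- `∫|u0|^n > 0` (`n ≥ 1`). [folklore] -/
theorem integral_norm_u0_pow_pos (n : ℕ) (hn : n ≠ 0) : 0 < ∫ x, ‖u0 x‖ ^ n := by
  obtain ⟨x₀, hx₀⟩ := Function.ne_iff.1 u0_ne_zero
  have hc : Continuous fun x => ‖u0 x‖ ^ n := (contDiff_u0.continuous.norm).pow n
  have hcs : HasCompactSupport fun x => ‖u0 x‖ ^ n :=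
    (hasCompactSupport_u0.norm).comp_left (g := fun r : ℝ => r ^ n) (by simp [hn])
  have h0 : (fun x => ‖u0 x‖ ^ n) x₀ ≠ 0 := by simpa [hn] using hx₀
  exact hc.integral_pos_of_hasCompactSupport_nonneg_nonzero hcs (fun x => by positivity) h0

/-- kit lemma (plumbing) [folklore] -/ theorem contDiff_u0_comp_smul (c : ℝ) : ContDiff ℝ ∞ (fun y => u0 (c • y)) :=
  contDiff_u0.comp (contDiff_const_smul c)

/-- kit lemma (plumbing) [folklore] -/ theorem hasCompactSupport_u0_comp_smul {c : ℝ} (hc : c ≠ 0) :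
    HasCompactSupport (fun y => u0 (c • y)) :=
  hasCompactSupport_u0.comp_smul hc

/-- kit lemma (plumbing) [folklore] -/ theorem decay_u0_comp_smul {c : ℝ} (hc : c ≠ 0) : HasRapidSpatialDecay (fun y => u0 (c • y)) :=
  HasRapidSpatialDecay.of_hasCompactSupport (contDiff_u0_comp_smul c) (hasCompactSupport_u0_comp_smul hc)

/-- kit lemma (plumbing) [folklore] -/ theorem divFree_u0_comp_smul (c : ℝ) : NSWave0.IsDivFree (fun y => u0 (c • y)) := by
  intro x
  have hx := isDivFree_u0 (c • x)
  simp only [VectorCalculus.divergence] at hx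
  simp only [NSWave0.divergence]
  rw [fderiv_comp_smul, ContinuousLinearMap.toLinearMap_smul, map_smul, hx, smul_zero]


/-- kit lemma (plumbing) [folklore] -/ theorem rpow_third_pow_six {x : ℝ} (hx : 0 ≤ x) : (x ^ ((1 : ℝ) / 3)) ^ 6 = x ^ 2 := by
  rw [← Real.rpow_natCast, ← Real.rpow_mul hx]
  norm_num

/-- kit lemma (plumbing) [folklore] -/ theorem rpow_sixth_pow_six {x : ℝ} (hx : 0 ≤ x) : (x ^ ((1 : ℝ) / 6)) ^ 6 = x := by
  rw [← Real.rpow_natCast, ← Real.rpow_mul hx]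
  norm_num


/-- The scaling arithmetic shared by the two Poincaré kills: with `c = min 1 (C_P E / (2(P+1)))`,
`C_P (c⁻¹ E) ≤ c P` is impossible (`E > 0`, `P ≥ 0`, `C_P > 0`). -/
theorem poincare_scaling_absurd {CP E P c : ℝ} (hCP : 0 < CP) (hE : 0 < E) (hP : 0 ≤ P)
    (hc : c = min 1 (CP * E / (2 * (P + 1)))) (key : CP * (c⁻¹ * E) ≤ c * P) : False := by
  have hcpos : 0 < c := by rw [hc]; exact lt_min one_pos (by positivity)
  have hc1 : c ≤ 1 := by rw [hc]; exact min_le_left _ _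
  have hc2 : c ≤ CP * E / (2 * (P + 1)) := by rw [hc]; exact min_le_right _ _
  have k1 : CP * E ≤ c ^ 2 * P := by
    have := mul_le_mul_of_nonneg_left key hcpos.le
    have e1 : c * (CP * (c⁻¹ * E)) = CP * E := by field_simp
    have e2 : c * (c * P) = c ^ 2 * P := by ring
    rwa [e1, e2] at this
  have k2 : c ^ 2 * P ≤ c * P := by
    have : 0 ≤ c * P * (1 - c) := mul_nonneg (mul_nonneg hcpos.le hP) (sub_nonneg.2 hc1)
    nlinarith [this]
  have k3 : c * P ≤ CP * E / (2 * (P + 1)) * P := mul_le_mul_of_nonneg_right hc2 hP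
  have k4 : CP * E / (2 * (P + 1)) * P < CP * E := by
    rw [div_mul_eq_mul_div, div_lt_iff₀ (by positivity)]
    nlinarith [mul_pos hCP hE]
  linarith


end Support

open Support

/-! ## The support kills -/

/-- **`¬ Step32_Young` (p.3 l.95–111)**: at `S = X = 3` the display reads `9 ≤ 5`.
[cite: PereiraSilva2025, p.3 l.95–111] -/
theorem not_Step32_Young : ¬ Step32_Young := by
  intro h
  have key := h 3 3 (by norm_num) (by norm_num)
  have h9 : (3 : ℝ) ^ (2 / 3 : ℝ) * (3 : ℝ) ^ (4 / 3 : ℝ) = 9 := by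
    rw [← Real.rpow_add (by norm_num : (0 : ℝ) < 3)]
    norm_num
  rw [h9] at key
  norm_num at key

/-- **`¬ Step2_GN K` (p.2 l.24–28, used at p.3 l.45–47)**, every `K`: the inequality with the 2-D
exponents is dilation-inhomogeneous on `ℝ³`; on `x ↦ u0(c x)` the left side scales like `c⁻¹` and the
right side like `c^{-7/6}`, so it fails for `c` large. [cite: PereiraSilva2025, §2 p.2 l.24–28] -/
theorem not_Step2_GN (K : Consts) : ¬ Step2_GN K := by
  intro h
  have hL := integral_norm_u0_pow_pos 3 (by norm_num)
  set L : ℝ := ∫ x, ‖u0 x‖ ^ 3 with hLdef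
  set E : ℝ := ∫ x, ‖u0 x‖ ^ 2 with hEdef
  set P : ℝ := gradsqF u0 with hPdef
  have hE : 0 ≤ E := integral_nonneg fun x => by positivity
  have hP : 0 ≤ P := integral_nonneg fun x => Finset.sum_nonneg fun j _ => by positivity
  have hCG := K.CG_pos
  set c : ℝ := K.CG ^ 6 * E ^ 2 * P / L ^ 2 + 1 with hc
  have hcpos : 0 < c := by positivity
  have key := h (fun x => u0 (c • x)) (contDiff_u0_comp_smul c) (decay_u0_comp_smul hcpos.ne')
  unfold l3 l2sq at key
  rw [integral_norm_comp_smul_pow u0 3 hcpos, integral_norm_comp_smul_pow u0 2 hcpos,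
    gradsqF_comp_smul u0 hcpos] at key
  rw [← hLdef, ← hEdef, ← hPdef] at key
  have hl0 : 0 ≤ ((c ^ 3)⁻¹ * L) ^ ((1 : ℝ) / 3) := by positivity
  have k6 := pow_le_pow_left₀ hl0 key 6
  have eq1 : (((c ^ 3)⁻¹ * L) ^ ((1 : ℝ) / 3)) ^ 6 = (c ^ 3)⁻¹ ^ 2 * L ^ 2 := by
    rw [rpow_third_pow_six (by positivity), mul_pow]
  have eq2 : (K.CG * ((c ^ 3)⁻¹ * E) ^ ((1 : ℝ) / 3) * (c⁻¹ * P) ^ ((1 : ℝ) / 6)) ^ 6 =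
      (c ^ 3)⁻¹ ^ 2 * (K.CG ^ 6 * E ^ 2 * P / c) := by
    rw [mul_pow, mul_pow, rpow_third_pow_six (by positivity), rpow_sixth_pow_six (by positivity)]
    ring
  rw [eq1, eq2] at k6
  -- k6 : (c⁻³)² L² ≤ (c⁻³)² (CG⁶ E² P / c)
  have k7 : L ^ 2 ≤ K.CG ^ 6 * E ^ 2 * P / c :=
    le_of_mul_le_mul_left k6 (by positivity)
  have k8 : K.CG ^ 6 * E ^ 2 * P / c < L ^ 2 := by
    rw [div_lt_iff₀ hcpos, hc]
    have hL2 : 0 < L ^ 2 := by positivity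
    nlinarith [mul_pos hL2 (show (0:ℝ) < K.CG ^ 6 * E ^ 2 * P / L ^ 2 + 1 by positivity),
      show K.CG ^ 6 * E ^ 2 * P = (K.CG ^ 6 * E ^ 2 * P / L ^ 2) * L ^ 2 by field_simp]
  linarith

/-- **`¬ Step2_Poincare K` (p.2 l.29–34)**, every `K`: on `x ↦ u0(c x)` the left side scales like `c⁻¹`
and the right side like `c`, so the «Poincaré inequality on ℝ³» fails for `c` small.
[cite: PereiraSilva2025, §2 p.2 l.29–34] -/
theorem not_Step2_Poincare (K : Consts) : ¬ Step2_Poincare K := by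
  intro h
  have hE := ens_pos isOuroDatum_u0
  set E : ℝ := ∫ x, ‖curl u0 x‖ ^ 2 with hEdef
  set P : ℝ := gradsqF (curl u0) with hPdef
  have hP : 0 ≤ P := integral_nonneg fun x => Finset.sum_nonneg fun j _ => by positivity
  have hCP := K.CP_pos
  set c : ℝ := min 1 (K.CP * E / (2 * (P + 1))) with hc
  have hcpos : 0 < c := lt_min one_pos (by positivity)
  have key := h (fun x => u0 (c • x)) (contDiff_u0_comp_smul c) (divFree_u0_comp_smul c)
    (decay_u0_comp_smul hcpos.ne')
  rw [l2sq_curl_comp_smul u0 hcpos, gradsqF_curl_comp_smul u0 hcpos] at key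
  unfold l2sq at key
  rw [← hEdef, ← hPdef] at key
  exact poincare_scaling_absurd hCP hE hP hc key

/-! ## FQN guards -/

example (K : Literature.Claims.NS.PereiraSilva2025.Consts) :
    ¬ Literature.Claims.NS.PereiraSilva2025.Step2_GN K := not_Step2_GN K
example (K : Literature.Claims.NS.PereiraSilva2025.Consts) :
    ¬ Literature.Claims.NS.PereiraSilva2025.Step2_Poincare K := not_Step2_Poincare K
example : ¬ Literature.Claims.NS.PereiraSilva2025.Step32_Young := not_Step32_Young

/-- info: 'Summit.NavierStokesRegularity.NavierStokesRegularity.Theorems.PereiraSilva2025.not_Step2_GN' depends on axioms: [propext,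
 Classical.choice,
 Quot.sound] -/
#guard_msgs in
#print axioms Summit.NavierStokesRegularity.NavierStokesRegularity.Theorems.PereiraSilva2025.not_Step2_GN

end Summit.NavierStokesRegularity.NavierStokesRegularity.Theorems.PereiraSilva2025

end
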